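import Summits.Ventures.PercRepro.S2FourteenElevenCf
import Summits.Ventures.PercRepro.S2FourteenElevenB
import Summits.Ventures.PercRepro.S2FourteenElevenC
import Summits.Ventures.PercRepro.S2ColoopSharp

/-!
# PercRepro — S2: THE CELL `(14, 11)` OF THE `q = 5` WINDOW (p1, gen 30, feeder for sub-claim S2; the `p = 14` row; p7's mechanism)

p7's double coloop split of `(14, 12)` at corank `11`: a coloop `e` is split off (`delete_core_data`), a second one `f` too; the scaled cells
`c025_thirteen_eleven_scaled_cf` ((13, 11) coloop-free at `K₁ = 13034`, `(Φ(14,5) − 2)/2`) and `c025_twelve_eleven_scaled` ((12, 11) on the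
standard caps at `K₂ = 14474`, `(Φ − 6)/4`) are lifted by the sharpened coloop steps; without coloops `c025_fourteen_eleven_cf` — the cell that
was priced OPEN (`1.007`) on the `Q*(7)` chain and closes (`0.990`) on the exact `s₄` cap `165` at nullity `10` (`Q*(8) = 23`).
**`ThmN.c025_core_five_fourteen_eleven (M) [M.Finite] (hR : ρ(E) = 14) (hn : |E| = 25) (hfree) : RLS M 14 5`**. Axioms: standard.
-/

open scoped Matroid

namespace PercRepro

namespace ThmN

variable {α : Type}

/-- **THE CELL `(14, 11)`**: by the double coloop split. -/
theorem c025_core_five_fourteen_eleven (M : Matroid α) [M.Finite]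
    (hR : M.eRank = ((14 : ℕ) : ℕ∞)) (hn : M.E.ncard = 14 + 11)
    (hfree : ∀ e ∈ M.E, ∃ A ⊆ M.E \ {e}, e ∉ M.closure A ∧ e ∉ M.closure ((M.E \ {e}) \ A)) : RLS M 14 5 := by
  classical
  by_cases hK : ∃ e, M.IsColoop e
  · obtain ⟨e, he⟩ := hK
    obtain ⟨hn', hR', hfree', -⟩ := delete_core_data M he (p := 13) (d := 11) (by rw [hR]) hn hfree
    rw [RLS_iff]
    by_cases hK' : ∃ f, (M ＼ {e}).IsColoop f
    · obtain ⟨f, hf⟩ := hK'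
      obtain ⟨hn'', hR'', hfree'', -⟩ := delete_core_data (M ＼ {e}) hf (p := 12) (d := 11) (by rw [hR']) hn' hfree'
      have key := c025_twelve_eleven_scaled ((M ＼ {e}) ＼ {f}) hR'' hn'' hfree''
      exact weighted_of_isColoop_scaled_sharp_iter M he hf (by norm_num : 4 + 1 < 12) (by rw [hR]) (phiK 14 5) key
    · push Not at hK'
      have key := c025_thirteen_eleven_scaled_cf (M ＼ {e}) hR' hn' hfree' hK'
      exact weighted_of_isColoop_scaled_sharp M he (by norm_num : 4 + 1 < 13) (by rw [hR]) (phiK 14 5) key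
  · push Not at hK
    exact c025_fourteen_eleven_cf M hR hn hfree hK

end ThmN

end PercRepro
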